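import Literature.MathematicalPhysics.QuantumLattice.HubbardBootstrapCertificate
import Literature.MathematicalPhysics.QuantumLattice.ContractionResidualBound
import HarnessLib

/-!
# Rounded bootstrap certificates with an explicit residual: `c − Σ|aₖ| ≤ E₀`

Family `hubbard` (trunk T-QLATTICE). A ROUNDED sum-of-squares / bootstrap certificate (Han 2020 §2;
Kull–Schuch–Dive–Navascués 2024 §5.3, "modify the dual to make it strictly feasible") is not an
exact identity `H − c·1 = Σ Λᵢⱼ Oᵢᴴ Oⱼ + null` but one with an exactly known RESIDUAL
`R = Σₖ aₖ Mₖ` (a linear combination of fermionic monomials `Mₖ`, each a contraction) plus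
further "null" operators `Nⱼ` whose expectation vanishes in the ground vector (e.g. monomials of
non-zero charge in a particle-number sector). This file glues
`Literature.MathematicalPhysics.QuantumManyBody.StateRelaxation.eigenvalue_ge_of_certificate`-style
reasoning with `Matrix.posSemidef_sum_smul_add_of_isContraction`:

* `eigenvalue_ge_of_certificate_residual`: `A v = E v`, `‖v‖ = 1`,
  `A − c·1 = gramForm Λ O + Σ null + Σ_j Nⱼ + R`, `R + ε·1 ⪰ 0`, `⟨v, Nⱼ v⟩ = 0` ⇒ `c − ε ≤ E`;
* `groundEnergyAt_ge_of_certificate_residual`: the Hubbard sector instance (`H = hamiltonian G t U`,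
  commutator and `N̂ − N` null terms as in `groundEnergyAt_ge_of_certificate`), residual given as
  `Σₖ aₖ Mₖ` with `Mₖ` products of ladder matrices, `ε = Σₖ ‖aₖ‖`.

The certificate files of the bundle papers/HubbardSuperconductivity/manybody-bootstrap/ (format
`certsdp/1`, mode `sector`) carry exactly these data: `Λ = L Lᵀ/4^K` (PSD by construction), the
multipliers (commutators / ideal terms), the residual polynomial `p = Σ_α p_α α`, and the claimed
bound `p_1 − Σ_{α ≠ 1, q(α)=0} |p_α|` — the charged monomials being the `Nⱼ` here.
Everything is PROVED; no named fact is introduced.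

## References
* X. Han, *Quantum many-body bootstrap*, arXiv:2006.06002 (2020), §2. [cite: Han2020Bootstrap, §2]
* I. Kull, N. Schuch, B. Dive, M. Navascués, PRX 14 (2024) 021008, §5.3. [cite: KullEtAl2024, §5.3]
-/

noncomputable section

open Matrix Finset
open scoped ComplexOrder MatrixOrder BigOperators

namespace Literature.MathematicalPhysics.QuantumManyBody.StateRelaxation

variable {n : Type*} [Fintype n] [DecidableEq n] {m : Type*} [Fintype m] [DecidableEq m]

/-- **Residual form of weak duality for an eigenvector.** [cite: KullEtAl2024, §5.3] -/
theorem eigenvalue_ge_of_certificate_residual {A : Matrix n n ℂ} (hA : A.IsHermitian) {E : ℝ}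
    {v : n → ℂ} (hv : star v ⬝ᵥ v = 1) (hAv : A *ᵥ v = (E : ℂ) • v)
    {Λ : Matrix m m ℂ} (hΛ : Λ.PosSemidef) (O : m → Matrix n n ℂ)
    {κ : Type*} (s : Finset κ) (X : κ → Matrix n n ℂ)
    {ι : Type*} (t : Finset ι) (Y Z Z' Y' : ι → Matrix n n ℂ)
    (hZ : ∀ l ∈ t, Z l *ᵥ v = 0) (hZ' : ∀ l ∈ t, (Z' l)ᴴ *ᵥ v = 0)
    {ι' : Type*} (u : Finset ι') (Nn : ι' → Matrix n n ℂ) (hNn : ∀ j ∈ u, star v ⬝ᵥ Nn j *ᵥ v = 0)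
    {R : Matrix n n ℂ} {ε : ℝ} (hR : (R + (ε : ℂ) • (1 : Matrix n n ℂ)).PosSemidef) {c : ℝ}
    (hcert : A - (c : ℂ) • (1 : Matrix n n ℂ) =
      gramForm Λ O + (∑ k ∈ s, (A * X k - X k * A) + ∑ l ∈ t, (Y l * Z l + Z' l * Y' l)) +
        ∑ j ∈ u, Nn j + R) :
    c - ε ≤ E := by
  set ω := vectorState v with hω
  have hpos : ∀ a : Matrix n n ℂ, 0 ≤ ω (star a * a) := fun a => vectorState_nonneg v a
  have hone : ω 1 = 1 := by rw [hω, vectorState_apply, one_mulVec, hv]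
  have hnull : ω (∑ k ∈ s, (A * X k - X k * A) + ∑ l ∈ t, (Y l * Z l + Z' l * Y' l)) = 0 := by
    rw [map_add, map_sum, map_sum]
    have h1 : ∀ k ∈ s, ω (A * X k - X k * A) = 0 := fun k _ => vectorState_commutator hA hAv _
    have h2 : ∀ l ∈ t, ω (Y l * Z l + Z' l * Y' l) = 0 := fun l hl => by
      rw [map_add, hω, vectorState_mul_of_mulVec_eq_zero v _ (hZ l hl),
        vectorState_mul_of_conjTranspose_mulVec_eq_zero v _ (hZ' l hl), add_zero]
    rw [Finset.sum_eq_zero h1, Finset.sum_eq_zero h2, add_zero]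
  have hN : ω (∑ j ∈ u, Nn j) = 0 := by
    rw [map_sum]
    exact Finset.sum_eq_zero fun j hj => by rw [hω, vectorState_apply]; exact hNn j hj
  have hgram := map_gramForm_nonneg ω hpos hΛ O
  have hRv : 0 ≤ ω (R + (ε : ℂ) • (1 : Matrix n n ℂ)) := by
    rw [hω, vectorState_apply]; exact hR.dotProduct_mulVec_nonneg v
  have hωA : ω A = (E : ℂ) := by
    rw [hω, vectorState_apply, hAv, dotProduct_smul, hv, smul_eq_mul, mul_one]
  have hkey := congrArg ω hcert
  rw [map_sub, map_smul, hone, hωA, map_add, map_add, map_add, hnull, hN, add_zero, add_zero,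
    smul_eq_mul, mul_one] at hkey
  rw [map_add, map_smul, hone, smul_eq_mul, mul_one] at hRv
  obtain ⟨hg, -⟩ := Complex.nonneg_iff.mp hgram
  obtain ⟨hr, -⟩ := Complex.nonneg_iff.mp hRv
  have := congrArg Complex.re hkey
  simp only [Complex.sub_re, Complex.ofReal_re, Complex.add_re] at this hr
  linarith

end Literature.MathematicalPhysics.QuantumManyBody.StateRelaxation

namespace Literature.MathematicalPhysics.QuantumLattice

open Literature.MathematicalPhysics.QuantumManyBody.StateRelaxation

variable {Λ : Type*} [LinearOrder Λ] [Fintype Λ] (G : SimpleGraph Λ) [DecidableRel G.Adj]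

/-- **Rounded bootstrap certificate for the Hubbard sector ground energy.** With
`H = hamiltonian G t U`, `N ≤ 2|Λ|`, an identity
`H − c·1 = Σᵢⱼ Λᵢⱼ Oᵢᴴ Oⱼ + Σₖ (H Xₖ − Xₖ H) + Σₗ (Yₗ (N̂ − N) + (N̂ − N) Y'ₗ) + Σⱼ Nⱼ + Σₖ aₖ Mₖ`
with `Λ ⪰ 0`, `Nⱼ` of vanishing sector expectation, `Mₖ` fermionic monomials (products of ladder
matrices) and `Σₖ aₖ Mₖ` Hermitian, proves `c − Σₖ ‖aₖ‖ ≤ groundEnergyAt G t U N`.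
[cite: Han2020Bootstrap, §2 eq. (3)] -/
theorem groundEnergyAt_ge_of_certificate_residual (t U : ℝ) {N : ℕ} (hN : N ≤ 2 * Fintype.card Λ)
    {m : Type*} [Fintype m] [DecidableEq m] {Λm : Matrix m m ℂ} (hΛ : Λm.PosSemidef)
    (O : m → Matrix (Finset (Orb Λ)) (Finset (Orb Λ)) ℂ)
    {κ : Type*} (s : Finset κ) (X : κ → Matrix (Finset (Orb Λ)) (Finset (Orb Λ)) ℂ)
    {κ' : Type*} (s' : Finset κ') (Y Y' : κ' → Matrix (Finset (Orb Λ)) (Finset (Orb Λ)) ℂ)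
    {ι' : Type*} (u : Finset ι') (Nn : ι' → Matrix (Finset (Orb Λ)) (Finset (Orb Λ)) ℂ)
    (hNn : ∀ j ∈ u, ∀ ψ : Fock (Orb Λ), IsNParticle N ψ → star ψ ⬝ᵥ Nn j *ᵥ ψ = 0)
    {κ'' : Type*} (w : Finset κ'') (a : κ'' → ℂ) (word : κ'' → List (Orb Λ × Bool))
    (hherm : (∑ k ∈ w, a k • ((word k).map fun p : Orb Λ × Bool =>
      if p.2 then creation p.1 else annihilation p.1).prod).IsHermitian)
    {c : ℝ}
    (hcert : hamiltonian G t U - (c : ℂ) • (1 : Matrix (Finset (Orb Λ)) (Finset (Orb Λ)) ℂ) =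
      gramForm Λm O + (∑ k ∈ s, (hamiltonian G t U * X k - X k * hamiltonian G t U) +
        ∑ l ∈ s', (Y l * (totalNumberOp - (N : ℂ) • 1) + (totalNumberOp - (N : ℂ) • 1) * Y' l)) +
        ∑ j ∈ u, Nn j +
        ∑ k ∈ w, a k • ((word k).map fun p : Orb Λ × Bool =>
          if p.2 then creation p.1 else annihilation p.1).prod) :
    c - ∑ k ∈ w, ‖a k‖ ≤ groundEnergyAt G t U N := by
  obtain ⟨ψ, hψN, hψ1, hHψ⟩ := ThermodynamicLimit.exists_unit_groundState G t U hN
  have hR := Matrix.posSemidef_sum_smul_add_of_isContraction w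
    (fun k => ((word k).map fun p : Orb Λ × Bool =>
      if p.2 then creation p.1 else annihilation p.1).prod)
    (fun k _ => isContraction_prod_ladder (word k)) a hherm
  exact eigenvalue_ge_of_certificate_residual (LiebThm1.hamiltonian_isHermitian G t U) hψ1 hHψ hΛ O
    s X s' Y (fun _ => totalNumberOp - (N : ℂ) • 1) (fun _ => totalNumberOp - (N : ℂ) • 1) Y'
    (fun _ _ => totalNumberOp_sub_mulVec_of_isNParticle N hψN)
    (fun _ _ => by
      rw [conjTranspose_totalNumberOp_sub]; exact totalNumberOp_sub_mulVec_of_isNParticle N hψN)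
    u Nn (fun j hj => hNn j hj ψ hψN) hR hcert

end Literature.MathematicalPhysics.QuantumLattice
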